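import Summits.QuantumFields.BalabanUV.InfraRed.StrongCouplingBallSeries
import Summits.QuantumFields.BalabanUV.InfraRed.StrongCouplingCertArith
import HarnessLib

/-!
# Strong-coupling front, J-SC16i: BALL CERTIFICATE — the rational brackets of the radial exponential moments of
`SU(2)` on the Dobrushin range and the certificate inequality they imply — observatory of the non-perturbative
crossover; no mass-gap claim

IR-3 v2 TWO-FRONT CROSSOVER LEDGER, front SC (`β₀`), SU(2), `d = 4`, Wilson normalisation `β_W = 4/g²`.
ABSOLUTE RULE of this package: No internally-minted statement may enter as a cited fact. Every hypothesis is either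
kernel-proved in this package or a verbatim quotation of a PUBLISHED theorem with page reference. The manuscript(s)
under audit are NOT citable for their own disputed steps — they are the thing under adjudication; programme-internal
(2001/route/tribunal) claims are never citable. Nothing is cited in this file: every statement is elementary and
proved here ([folklore] labels are attributions, not citations).

WHAT THIS FILE PROVES (third brick of the kernel port of the ball-flux certificate for the tree's typed open node
`StrongCouplingQuarterCovariance.QuarterCovariance`).  Notation (informal only; the statements spell everything out):
`σ` = Haar probability measure of `SU(2)`, `x₀ = Re g₀₀`, `0 ≤ κ ≤ 4/3`, `Z = ∫ e^{κx₀} dσ`, `Z' = ∫ x₀ e^{κx₀} dσ`,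
`J(a,k) = ∫₀¹ r^a ∫ x₀^k e^{κ r x₀} dσ dr`, `z_B = J(3,0)`, `m₂ = J(5,0)`, `Jak = J(a,k)`.
* `moment_table`: `∫ x₀ⁿ dσ = 1, 0, 1/4, 0, 1/8, 0, 5/64, 0, 7/128, 0, 21/512, 0` for `n = 0 … 11` (from the tree);
* `Z_bracket`, `Zp_bracket`, `zB_bracket`, `J41_lower`: the SYMBOLIC two-sided Taylor brackets (polynomials in `κ` of
  degree `≤ 9`, remainder `4κ¹⁰/10!`) obtained by evaluating `sphere_bracket` / `ball_bracket` of
  `StrongCouplingBallSeries` on the moment table;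
* `m2_le`, `J52_le`, `J72_le`, `J63_le`, `J74_le`, `ball_nonneg`: the NUMERICAL brackets
  `0 ≤ m₂ ≤ 1/5`, `0 ≤ J52 ≤ 57/1000`, `0 ≤ J72 ≤ 9/200`, `0 ≤ J63 ≤ 13/500`, `0 ≤ J74 ≤ 1/40`, `0 ≤ J61`;
* `rational_brackets`: the polynomial bookkeeping `1 ≤ Z ≤ 5/4`, `κ/4 ≤ Z' ≤ 29κ/100`, `1/4 ≤ z_B ≤ 29/100` and the
  three CANCELLATION brackets `0 ≤ 4Z' − κZ + κ³Z/20 ≤ (2/125)κ³`, `0 ≤ κZ − 4Z' ≤ (117/2500)κ³`, `κ²/25 ≤ Z − 4z_B`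
  (these carry the `O(κ³)` / `O(κ²)` cancellations symbolically — a piecewise-constant evaluation would lose them);
* `ball_certificate`: feeding all of the above into `StrongCouplingCertArith.cert_arith` — for every `0 < κ ≤ 4/3`,
  `16 · m₂ · h₂ · z_B ≤ (Z² − 16 z_B²)(z_B − q_V)` with `h₂ = c₀² z_B + 2c₀c₁ J41 + (c₁² + 2c₀c₂) J52 + 2c₁c₂ J63
  + c₂² J74`, `q_V = A² z_B + 2Aε J52 − 2Aτ J41 + ε² J72 − 2ετ J61 + τ² m₂`, `τ = Z'/Z`, `A = 1 − κ²/20`,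
  `ε = κ²/20`, `c₀ = κA − 4τ`, `c₁ = κ²/4 − κτ`, `c₂ = κ³/20`.  (In the flux argument of the companion leaves, `h₂`
  bounds the mean square of the divergence of the test field and `q_V` its quadratic part; this file makes no such
  claim — it is an inequality between explicit integrals.)
METHOD: `Finset.sum_range_succ` + the moment table + `norm_num` for the expansions; monomial bounds
`κ^(j+i) ≤ (4/3)^j κ^i` and `linarith` for the bookkeeping.  No definitions, no `local notation`, no numerics beyond
`norm_num` / `linarith` on explicit rationals; every series is the tree's (`hasSum_ball`, `hasSum_integral_pow_mul_exp`).

NOT CLAIMED: anything about tilted measures, fluxes or `QuarterCovariance` (later leaves); no mass-gap claim.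
-/

noncomputable section

open MeasureTheory Filter Finset Real intervalIntegral
open scoped NNReal Quaternion Matrix BigOperators Topology Nat
open Matrix Complex
open Literature.MathematicalPhysics.QuantumLattice (su2Quat)
open Literature.MathematicalPhysics.QuantumFieldTheory
open Literature.MathematicalPhysics.QuantumFieldTheory.Balaban1983to89.StrongCouplingVarianceWindow
  (integral_re_pow_odd integral_re_sq)
open Summit.QuantumFields.BalabanUV.InfraRed.StrongCouplingBallSeries
open Summit.QuantumFields.BalabanUV.InfraRed.StrongCouplingCertArith (cert_arith)

namespace Summit.QuantumFields.BalabanUV.InfraRed.StrongCouplingBallCertificate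

/-! ## 1. The moment table `m₀ … m₁₁` -/

/-- The moments `∫ x₀ⁿ dσ`, `n = 0 … 11`, of the Haar probability measure of `SU(2)`:
`1, 0, 1/4, 0, 1/8, 0, 5/64, 0, 7/128, 0, 21/512, 0`. [folklore] -/
theorem moment_table :
    (∫ g : Matrix.specialUnitaryGroup (Fin 2) ℂ, (su2Quat g).re ^ 0
        ∂haarProbability (Matrix.specialUnitaryGroup (Fin 2) ℂ) = 1) ∧
    (∫ g : Matrix.specialUnitaryGroup (Fin 2) ℂ, (su2Quat g).re ^ 1
        ∂haarProbability (Matrix.specialUnitaryGroup (Fin 2) ℂ) = 0) ∧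
    (∫ g : Matrix.specialUnitaryGroup (Fin 2) ℂ, (su2Quat g).re ^ 2
        ∂haarProbability (Matrix.specialUnitaryGroup (Fin 2) ℂ) = 1 / 4) ∧
    (∫ g : Matrix.specialUnitaryGroup (Fin 2) ℂ, (su2Quat g).re ^ 3
        ∂haarProbability (Matrix.specialUnitaryGroup (Fin 2) ℂ) = 0) ∧
    (∫ g : Matrix.specialUnitaryGroup (Fin 2) ℂ, (su2Quat g).re ^ 4
        ∂haarProbability (Matrix.specialUnitaryGroup (Fin 2) ℂ) = 1 / 8) ∧
    (∫ g : Matrix.specialUnitaryGroup (Fin 2) ℂ, (su2Quat g).re ^ 5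
        ∂haarProbability (Matrix.specialUnitaryGroup (Fin 2) ℂ) = 0) ∧
    (∫ g : Matrix.specialUnitaryGroup (Fin 2) ℂ, (su2Quat g).re ^ 6
        ∂haarProbability (Matrix.specialUnitaryGroup (Fin 2) ℂ) = 5 / 64) ∧
    (∫ g : Matrix.specialUnitaryGroup (Fin 2) ℂ, (su2Quat g).re ^ 7
        ∂haarProbability (Matrix.specialUnitaryGroup (Fin 2) ℂ) = 0) ∧
    (∫ g : Matrix.specialUnitaryGroup (Fin 2) ℂ, (su2Quat g).re ^ 8
        ∂haarProbability (Matrix.specialUnitaryGroup (Fin 2) ℂ) = 7 / 128) ∧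
    (∫ g : Matrix.specialUnitaryGroup (Fin 2) ℂ, (su2Quat g).re ^ 9
        ∂haarProbability (Matrix.specialUnitaryGroup (Fin 2) ℂ) = 0) ∧
    (∫ g : Matrix.specialUnitaryGroup (Fin 2) ℂ, (su2Quat g).re ^ 10
        ∂haarProbability (Matrix.specialUnitaryGroup (Fin 2) ℂ) = 21 / 512) ∧
    (∫ g : Matrix.specialUnitaryGroup (Fin 2) ℂ, (su2Quat g).re ^ 11
        ∂haarProbability (Matrix.specialUnitaryGroup (Fin 2) ℂ) = 0) :=
  ⟨by simp, odd_moments.1, integral_re_sq, odd_moments.2.1, even_moments.1, odd_moments.2.2.1,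
    even_moments.2.1, odd_moments.2.2.2.1, even_moments.2.2.1, odd_moments.2.2.2.2.1, even_moments.2.2.2,
    odd_moments.2.2.2.2.2⟩

/-! ## 2. Symbolic brackets (polynomials in `κ`) of `Z`, `Z'`, `z_B`, and the first term of `J41` -/

/-- `Z = ∫ e^{κ x₀} dσ` is bracketed by its degree-`8` Taylor polynomial, `0 ≤ κ ≤ 4/3`. [folklore] -/
theorem Z_bracket {κ : ℝ} (hκ : 0 ≤ κ) (hκ' : κ ≤ 4 / 3) :
    1 + κ ^ 2 / 8 + κ ^ 4 / 192 + κ ^ 6 / 9216 + κ ^ 8 / 737280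
      ≤ ∫ g : Matrix.specialUnitaryGroup (Fin 2) ℂ, Real.exp (κ * (su2Quat g).re)
          ∂haarProbability (Matrix.specialUnitaryGroup (Fin 2) ℂ) ∧
    ∫ g : Matrix.specialUnitaryGroup (Fin 2) ℂ, Real.exp (κ * (su2Quat g).re)
          ∂haarProbability (Matrix.specialUnitaryGroup (Fin 2) ℂ)
      ≤ 1 + κ ^ 2 / 8 + κ ^ 4 / 192 + κ ^ 6 / 9216 + κ ^ 8 / 737280 + 4 * κ ^ 10 / 3628800 := by
  have h := sphere_bracket 0 hκ hκ' 10
  obtain ⟨m0, m1, m2, m3, m4, m5, m6, m7, m8, m9, -, -⟩ := moment_table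
  simp only [sum_range_succ, sum_range_zero, Nat.reduceAdd, m0, m1, m2, m3, m4, m5, m6, m7, m8, m9,
    Nat.factorial, Nat.succ_eq_add_one, Nat.reduceMul, Nat.cast_ofNat, Nat.cast_one] at h
  simp only [pow_zero, one_mul] at h
  norm_num at h
  constructor <;> linarith [h.1, h.2]

/-- `Z' = ∫ x₀ e^{κ x₀} dσ` is bracketed by its degree-`9` Taylor polynomial, `0 ≤ κ ≤ 4/3`. [folklore] -/
theorem Zp_bracket {κ : ℝ} (hκ : 0 ≤ κ) (hκ' : κ ≤ 4 / 3) :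
    κ / 4 + κ ^ 3 / 48 + κ ^ 5 / 1536 + κ ^ 7 / 92160 + κ ^ 9 / 8847360
      ≤ ∫ g : Matrix.specialUnitaryGroup (Fin 2) ℂ, (su2Quat g).re * Real.exp (κ * (su2Quat g).re)
          ∂haarProbability (Matrix.specialUnitaryGroup (Fin 2) ℂ) ∧
    ∫ g : Matrix.specialUnitaryGroup (Fin 2) ℂ, (su2Quat g).re * Real.exp (κ * (su2Quat g).re)
          ∂haarProbability (Matrix.specialUnitaryGroup (Fin 2) ℂ)
      ≤ κ / 4 + κ ^ 3 / 48 + κ ^ 5 / 1536 + κ ^ 7 / 92160 + κ ^ 9 / 8847360 + 4 * κ ^ 10 / 3628800 := by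
  have h := sphere_bracket 1 hκ hκ' 10
  obtain ⟨-, m1, m2, m3, m4, m5, m6, m7, m8, m9, m10, -⟩ := moment_table
  simp only [sum_range_succ, sum_range_zero, Nat.reduceAdd, m1, m2, m3, m4, m5, m6, m7, m8, m9, m10,
    Nat.factorial, Nat.succ_eq_add_one, Nat.reduceMul, Nat.cast_ofNat, Nat.cast_one] at h
  simp only [pow_one] at h
  norm_num at h
  constructor <;> linarith [h.1, h.2]

/-- `z_B = ∫₀¹ r³ ∫ e^{κ r x₀} dσ dr` is bracketed by its degree-`8` polynomial, `0 ≤ κ ≤ 4/3`. [folklore] -/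
theorem zB_bracket {κ : ℝ} (hκ : 0 ≤ κ) (hκ' : κ ≤ 4 / 3) :
    1 / 4 + κ ^ 2 / 48 + κ ^ 4 / 1536 + κ ^ 6 / 92160 + κ ^ 8 / 8847360
      ≤ ∫ r in (0:ℝ)..1, r ^ 3 * ∫ g : Matrix.specialUnitaryGroup (Fin 2) ℂ,
          Real.exp (κ * r * (su2Quat g).re) ∂haarProbability (Matrix.specialUnitaryGroup (Fin 2) ℂ) ∧
    ∫ r in (0:ℝ)..1, r ^ 3 * ∫ g : Matrix.specialUnitaryGroup (Fin 2) ℂ,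
          Real.exp (κ * r * (su2Quat g).re) ∂haarProbability (Matrix.specialUnitaryGroup (Fin 2) ℂ)
      ≤ 1 / 4 + κ ^ 2 / 48 + κ ^ 4 / 1536 + κ ^ 6 / 92160 + κ ^ 8 / 8847360 + 4 * κ ^ 10 / 3628800 := by
  have h := ball_bracket 0 3 hκ hκ' 10
  obtain ⟨m0, m1, m2, m3, m4, m5, m6, m7, m8, m9, -, -⟩ := moment_table
  simp only [sum_range_succ, sum_range_zero, Nat.reduceAdd, m0, m1, m2, m3, m4, m5, m6, m7, m8, m9,
    Nat.factorial, Nat.succ_eq_add_one, Nat.reduceMul, Nat.cast_ofNat, Nat.cast_one] at h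
  simp only [pow_zero, one_mul] at h
  norm_num at h
  constructor <;> linarith [h.1, h.2]

/-- `J41 = ∫₀¹ r⁴ ∫ x₀ e^{κ r x₀} dσ dr ≥ κ/24` (its first non-zero Taylor term), `0 ≤ κ ≤ 4/3`. [folklore] -/
theorem J41_lower {κ : ℝ} (hκ : 0 ≤ κ) (hκ' : κ ≤ 4 / 3) :
    κ / 24 ≤ ∫ r in (0:ℝ)..1, r ^ 4 * ∫ g : Matrix.specialUnitaryGroup (Fin 2) ℂ,
          (su2Quat g).re * Real.exp (κ * r * (su2Quat g).re) ∂haarProbability (Matrix.specialUnitaryGroup (Fin 2) ℂ) := by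
  have h := (ball_bracket 1 4 hκ hκ' 2).1
  obtain ⟨-, m1, m2, -⟩ := moment_table
  simp only [sum_range_succ, sum_range_zero, Nat.reduceAdd, m1, m2,
    Nat.factorial, Nat.succ_eq_add_one, Nat.reduceMul, Nat.cast_ofNat, Nat.cast_one] at h
  simp only [pow_one] at h
  norm_num at h
  linarith

/-! ## 3. Numerical brackets of `m₂`, `J52`, `J61`, `J72`, `J63`, `J74` -/

/-- Every ball moment is non-negative (empty partial sum). [folklore] -/
theorem ball_nonneg (k a : ℕ) {κ : ℝ} (hκ : 0 ≤ κ) (hκ' : κ ≤ 4 / 3) :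
    0 ≤ ∫ r in (0:ℝ)..1, r ^ a * ∫ g : Matrix.specialUnitaryGroup (Fin 2) ℂ,
        (su2Quat g).re ^ k * Real.exp (κ * r * (su2Quat g).re) ∂haarProbability (Matrix.specialUnitaryGroup (Fin 2) ℂ) := by
  simpa using (ball_bracket k a hκ hκ' 0).1

/-- `m₂ = ∫₀¹ r⁵ ∫ e^{κ r x₀} dσ dr ≤ 1/5` on `0 ≤ κ ≤ 4/3`. [folklore] -/
theorem m2_le {κ : ℝ} (hκ : 0 ≤ κ) (hκ' : κ ≤ 4 / 3) :
    ∫ r in (0:ℝ)..1, r ^ 5 * ∫ g : Matrix.specialUnitaryGroup (Fin 2) ℂ,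
        Real.exp (κ * r * (su2Quat g).re) ∂haarProbability (Matrix.specialUnitaryGroup (Fin 2) ℂ) ≤ 1 / 5 := by
  have h := ball_le_eval 0 5 hκ hκ' 10
  obtain ⟨m0, m1, m2, m3, m4, m5, m6, m7, m8, m9, -, -⟩ := moment_table
  simp only [sum_range_succ, sum_range_zero, Nat.reduceAdd, m0, m1, m2, m3, m4, m5, m6, m7, m8, m9,
    Nat.factorial, Nat.succ_eq_add_one, Nat.reduceMul, Nat.cast_ofNat, Nat.cast_one] at h
  simp only [pow_zero, one_mul] at h
  norm_num at h
  linarith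

/-- `J52 = ∫₀¹ r⁵ ∫ x₀² e^{κ r x₀} dσ dr ≤ 57/1000` on `0 ≤ κ ≤ 4/3`. [folklore] -/
theorem J52_le {κ : ℝ} (hκ : 0 ≤ κ) (hκ' : κ ≤ 4 / 3) :
    ∫ r in (0:ℝ)..1, r ^ 5 * ∫ g : Matrix.specialUnitaryGroup (Fin 2) ℂ,
        (su2Quat g).re ^ 2 * Real.exp (κ * r * (su2Quat g).re) ∂haarProbability (Matrix.specialUnitaryGroup (Fin 2) ℂ)
      ≤ 57 / 1000 := by
  have h := ball_le_eval 2 5 hκ hκ' 10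
  obtain ⟨-, -, m2, m3, m4, m5, m6, m7, m8, m9, m10, m11⟩ := moment_table
  simp only [sum_range_succ, sum_range_zero, Nat.reduceAdd, m2, m3, m4, m5, m6, m7, m8, m9, m10, m11,
    Nat.factorial, Nat.succ_eq_add_one, Nat.reduceMul, Nat.cast_ofNat, Nat.cast_one] at h
  norm_num at h
  linarith

/-- `J72 = ∫₀¹ r⁷ ∫ x₀² e^{κ r x₀} dσ dr ≤ 9/200` on `0 ≤ κ ≤ 4/3`. [folklore] -/
theorem J72_le {κ : ℝ} (hκ : 0 ≤ κ) (hκ' : κ ≤ 4 / 3) :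
    ∫ r in (0:ℝ)..1, r ^ 7 * ∫ g : Matrix.specialUnitaryGroup (Fin 2) ℂ,
        (su2Quat g).re ^ 2 * Real.exp (κ * r * (su2Quat g).re) ∂haarProbability (Matrix.specialUnitaryGroup (Fin 2) ℂ)
      ≤ 9 / 200 := by
  have h := ball_le_eval 2 7 hκ hκ' 8
  obtain ⟨-, -, m2, m3, m4, m5, m6, m7, m8, m9, -, -⟩ := moment_table
  simp only [sum_range_succ, sum_range_zero, Nat.reduceAdd, m2, m3, m4, m5, m6, m7, m8, m9,
    Nat.factorial, Nat.succ_eq_add_one, Nat.reduceMul, Nat.cast_ofNat, Nat.cast_one] at h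
  norm_num at h
  linarith

/-- `J63 = ∫₀¹ r⁶ ∫ x₀³ e^{κ r x₀} dσ dr ≤ 13/500` on `0 ≤ κ ≤ 4/3`. [folklore] -/
theorem J63_le {κ : ℝ} (hκ : 0 ≤ κ) (hκ' : κ ≤ 4 / 3) :
    ∫ r in (0:ℝ)..1, r ^ 6 * ∫ g : Matrix.specialUnitaryGroup (Fin 2) ℂ,
        (su2Quat g).re ^ 3 * Real.exp (κ * r * (su2Quat g).re) ∂haarProbability (Matrix.specialUnitaryGroup (Fin 2) ℂ)
      ≤ 13 / 500 := by
  have h := ball_le_eval 3 6 hκ hκ' 8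
  obtain ⟨-, -, -, m3, m4, m5, m6, m7, m8, m9, m10, -⟩ := moment_table
  simp only [sum_range_succ, sum_range_zero, Nat.reduceAdd, m3, m4, m5, m6, m7, m8, m9, m10,
    Nat.factorial, Nat.succ_eq_add_one, Nat.reduceMul, Nat.cast_ofNat, Nat.cast_one] at h
  norm_num at h
  linarith

/-- `J74 = ∫₀¹ r⁷ ∫ x₀⁴ e^{κ r x₀} dσ dr ≤ 1/40` on `0 ≤ κ ≤ 4/3`. [folklore] -/
theorem J74_le {κ : ℝ} (hκ : 0 ≤ κ) (hκ' : κ ≤ 4 / 3) :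
    ∫ r in (0:ℝ)..1, r ^ 7 * ∫ g : Matrix.specialUnitaryGroup (Fin 2) ℂ,
        (su2Quat g).re ^ 4 * Real.exp (κ * r * (su2Quat g).re) ∂haarProbability (Matrix.specialUnitaryGroup (Fin 2) ℂ)
      ≤ 1 / 40 := by
  have h := ball_le_eval 4 7 hκ hκ' 8
  obtain ⟨-, -, -, -, m4, m5, m6, m7, m8, m9, m10, m11⟩ := moment_table
  simp only [sum_range_succ, sum_range_zero, Nat.reduceAdd, m4, m5, m6, m7, m8, m9, m10, m11,
    Nat.factorial, Nat.succ_eq_add_one, Nat.reduceMul, Nat.cast_ofNat, Nat.cast_one] at h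
  norm_num at h
  linarith

/-! ## 4. From the symbolic brackets to the rational brackets of the certificate -/

/-- `κ^(j+i) ≤ (4/3)^j κ^i` on `0 ≤ κ ≤ 4/3`. [folklore] -/
theorem pow_le_mul {κ : ℝ} (hκ : 0 ≤ κ) (hκ' : κ ≤ 4 / 3) (j i : ℕ) :
    κ ^ (j + i) ≤ (4 / 3 : ℝ) ^ j * κ ^ i := by
  rw [pow_add]
  exact mul_le_mul_of_nonneg_right (pow_le_pow_left₀ hκ hκ' j) (pow_nonneg hκ i)

/-- **Polynomial bookkeeping.** From the three symbolic brackets: the rational brackets of `Z, Z', z_B` and the three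
CANCELLATION brackets `0 ≤ 4Z' − κZ + κ³Z/20 ≤ (2/125)κ³`, `0 ≤ κZ − 4Z' ≤ (117/2500)κ³`, `κ²/25 ≤ Z − 4 z_B`
(`0 ≤ κ ≤ 4/3`). [folklore] -/
theorem rational_brackets {κ Z Zp zB : ℝ} (hκ : 0 ≤ κ) (hκ' : κ ≤ 4 / 3)
    (hZl : 1 + κ ^ 2 / 8 + κ ^ 4 / 192 + κ ^ 6 / 9216 + κ ^ 8 / 737280 ≤ Z)
    (hZu : Z ≤ 1 + κ ^ 2 / 8 + κ ^ 4 / 192 + κ ^ 6 / 9216 + κ ^ 8 / 737280 + 4 * κ ^ 10 / 3628800)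
    (hZpl : κ / 4 + κ ^ 3 / 48 + κ ^ 5 / 1536 + κ ^ 7 / 92160 + κ ^ 9 / 8847360 ≤ Zp)
    (hZpu : Zp ≤ κ / 4 + κ ^ 3 / 48 + κ ^ 5 / 1536 + κ ^ 7 / 92160 + κ ^ 9 / 8847360 + 4 * κ ^ 10 / 3628800)
    (hBl : 1 / 4 + κ ^ 2 / 48 + κ ^ 4 / 1536 + κ ^ 6 / 92160 + κ ^ 8 / 8847360 ≤ zB)
    (hBu : zB ≤ 1 / 4 + κ ^ 2 / 48 + κ ^ 4 / 1536 + κ ^ 6 / 92160 + κ ^ 8 / 8847360 + 4 * κ ^ 10 / 3628800) :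
    1 ≤ Z ∧ Z ≤ 5 / 4 ∧ κ / 4 ≤ Zp ∧ Zp ≤ 29 / 100 * κ ∧ 1 / 4 ≤ zB ∧ zB ≤ 29 / 100 ∧
    0 ≤ 4 * Zp - κ * Z + κ ^ 3 * Z / 20 ∧ 4 * Zp - κ * Z + κ ^ 3 * Z / 20 ≤ 2 / 125 * κ ^ 3 ∧
    0 ≤ κ * Z - 4 * Zp ∧ κ * Z - 4 * Zp ≤ 117 / 2500 * κ ^ 3 ∧ κ ^ 2 / 25 ≤ Z - 4 * zB := by
  -- monomial bounds on `[0, 4/3]`: constants, multiples of `κ`, of `κ²`, of `κ³`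
  have c2 := pow_le_mul hκ hκ' 2 0
  have c4 := pow_le_mul hκ hκ' 4 0
  have c6 := pow_le_mul hκ hκ' 6 0
  have c8 := pow_le_mul hκ hκ' 8 0
  have c10 := pow_le_mul hκ hκ' 10 0
  have l3 := pow_le_mul hκ hκ' 2 1
  have l5 := pow_le_mul hκ hκ' 4 1
  have l7 := pow_le_mul hκ hκ' 6 1
  have l9 := pow_le_mul hκ hκ' 8 1
  have l10 := pow_le_mul hκ hκ' 9 1
  have q10 := pow_le_mul hκ hκ' 8 2
  have k5 := pow_le_mul hκ hκ' 2 3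
  have k7 := pow_le_mul hκ hκ' 4 3
  have k9 := pow_le_mul hκ hκ' 6 3
  have k10 := pow_le_mul hκ hκ' 7 3
  have k11 := pow_le_mul hκ hκ' 8 3
  have k13 := pow_le_mul hκ hκ' 10 3
  norm_num at c2 c4 c6 c8 c10 l3 l5 l7 l9 l10 q10 k5 k7 k9 k10 k11 k13
  have p2 : 0 ≤ κ ^ 2 := by positivity
  have p3 : 0 ≤ κ ^ 3 := by positivity
  have p4 : 0 ≤ κ ^ 4 := by positivity
  have p5 : 0 ≤ κ ^ 5 := by positivity
  have p6 : 0 ≤ κ ^ 6 := by positivity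
  have p7 : 0 ≤ κ ^ 7 := by positivity
  have p8 : 0 ≤ κ ^ 8 := by positivity
  have p9 : 0 ≤ κ ^ 9 := by positivity
  have p10 : 0 ≤ κ ^ 10 := by positivity
  -- the products `κ · Z`, `κ³ · Z` against the brackets of `Z`, expanded into monomials
  have e3 : κ * Z ≤ κ + κ ^ 3 / 8 + κ ^ 5 / 192 + κ ^ 7 / 9216 + κ ^ 9 / 737280 + 4 * κ ^ 11 / 3628800 := by
    linear_combination mul_le_mul_of_nonneg_left hZu hκ
  have e4 : κ + κ ^ 3 / 8 + κ ^ 5 / 192 + κ ^ 7 / 9216 + κ ^ 9 / 737280 ≤ κ * Z := by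
    linear_combination mul_le_mul_of_nonneg_left hZl hκ
  have e5 : κ ^ 3 + κ ^ 5 / 8 + κ ^ 7 / 192 + κ ^ 9 / 9216 + κ ^ 11 / 737280 ≤ κ ^ 3 * Z := by
    linear_combination mul_le_mul_of_nonneg_left hZl p3
  have e6 : κ ^ 3 * Z ≤ κ ^ 3 + κ ^ 5 / 8 + κ ^ 7 / 192 + κ ^ 9 / 9216 + κ ^ 11 / 737280
      + 4 * κ ^ 13 / 3628800 := by
    linear_combination mul_le_mul_of_nonneg_left hZu p3
  refine ⟨?_, ?_, ?_, ?_, ?_, ?_, ?_, ?_, ?_, ?_, ?_⟩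
  · linarith
  · linarith
  · linarith
  · linarith
  · linarith
  · linarith
  · linarith
  · linarith
  · linarith
  · linarith
  · linarith

/-! ## 5. The certificate -/

/-- **The ball-flux certificate.** For `0 < κ ≤ 4/3` let `Z = ∫ e^{κx₀} dσ`, `Z' = ∫ x₀ e^{κx₀} dσ` and
`J(a,k) = ∫₀¹ r^a ∫ x₀^k e^{κ r x₀} dσ dr` (`z_B = J(3,0)`, `m₂ = J(5,0)`, `J41, J52, J61, J72, J63, J74`), `τ = Z'/Z`,
`A = 1 − κ²/20`, `ε = κ²/20`, `c₀ = κA − 4τ`, `c₁ = κ²/4 − κτ`, `c₂ = κ³/20`.  Then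
`16 · m₂ · (c₀² z_B + 2c₀c₁ J41 + (c₁² + 2c₀c₂) J52 + 2c₁c₂ J63 + c₂² J74) · z_B`
`≤ (Z² − 16 z_B²) · (z_B − (A² z_B + 2Aε J52 − 2Aτ J41 + ε² J72 − 2ετ J61 + τ² m₂))`. [folklore] -/
theorem ball_certificate {κ Z Zp zB m2 J41 J52 J61 J72 J63 J74 : ℝ} (hκ0 : 0 < κ) (hκ1 : κ ≤ 4 / 3)
    (hZ : Z = ∫ g : Matrix.specialUnitaryGroup (Fin 2) ℂ, Real.exp (κ * (su2Quat g).re) ∂haarProbability (Matrix.specialUnitaryGroup (Fin 2) ℂ))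
    (hZp : Zp = ∫ g : Matrix.specialUnitaryGroup (Fin 2) ℂ, (su2Quat g).re * Real.exp (κ * (su2Quat g).re)
        ∂haarProbability (Matrix.specialUnitaryGroup (Fin 2) ℂ))
    (hzB : zB = ∫ r in (0:ℝ)..1, r ^ 3 * ∫ g : Matrix.specialUnitaryGroup (Fin 2) ℂ,
        Real.exp (κ * r * (su2Quat g).re) ∂haarProbability (Matrix.specialUnitaryGroup (Fin 2) ℂ))
    (hm2 : m2 = ∫ r in (0:ℝ)..1, r ^ 5 * ∫ g : Matrix.specialUnitaryGroup (Fin 2) ℂ,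
        Real.exp (κ * r * (su2Quat g).re) ∂haarProbability (Matrix.specialUnitaryGroup (Fin 2) ℂ))
    (hJ41 : J41 = ∫ r in (0:ℝ)..1, r ^ 4 * ∫ g : Matrix.specialUnitaryGroup (Fin 2) ℂ,
        (su2Quat g).re * Real.exp (κ * r * (su2Quat g).re) ∂haarProbability (Matrix.specialUnitaryGroup (Fin 2) ℂ))
    (hJ52 : J52 = ∫ r in (0:ℝ)..1, r ^ 5 * ∫ g : Matrix.specialUnitaryGroup (Fin 2) ℂ,
        (su2Quat g).re ^ 2 * Real.exp (κ * r * (su2Quat g).re) ∂haarProbability (Matrix.specialUnitaryGroup (Fin 2) ℂ))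
    (hJ61 : J61 = ∫ r in (0:ℝ)..1, r ^ 6 * ∫ g : Matrix.specialUnitaryGroup (Fin 2) ℂ,
        (su2Quat g).re * Real.exp (κ * r * (su2Quat g).re) ∂haarProbability (Matrix.specialUnitaryGroup (Fin 2) ℂ))
    (hJ72 : J72 = ∫ r in (0:ℝ)..1, r ^ 7 * ∫ g : Matrix.specialUnitaryGroup (Fin 2) ℂ,
        (su2Quat g).re ^ 2 * Real.exp (κ * r * (su2Quat g).re) ∂haarProbability (Matrix.specialUnitaryGroup (Fin 2) ℂ))
    (hJ63 : J63 = ∫ r in (0:ℝ)..1, r ^ 6 * ∫ g : Matrix.specialUnitaryGroup (Fin 2) ℂ,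
        (su2Quat g).re ^ 3 * Real.exp (κ * r * (su2Quat g).re) ∂haarProbability (Matrix.specialUnitaryGroup (Fin 2) ℂ))
    (hJ74 : J74 = ∫ r in (0:ℝ)..1, r ^ 7 * ∫ g : Matrix.specialUnitaryGroup (Fin 2) ℂ,
        (su2Quat g).re ^ 4 * Real.exp (κ * r * (su2Quat g).re) ∂haarProbability (Matrix.specialUnitaryGroup (Fin 2) ℂ)) :
    16 * m2 * ((κ * (1 - κ ^ 2 / 20) - 4 * (Zp / Z)) ^ 2 * zB
        + 2 * (κ * (1 - κ ^ 2 / 20) - 4 * (Zp / Z)) * (κ ^ 2 / 4 - κ * (Zp / Z)) * J41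
        + ((κ ^ 2 / 4 - κ * (Zp / Z)) ^ 2 + 2 * (κ * (1 - κ ^ 2 / 20) - 4 * (Zp / Z)) * (κ ^ 3 / 20)) * J52
        + 2 * (κ ^ 2 / 4 - κ * (Zp / Z)) * (κ ^ 3 / 20) * J63 + (κ ^ 3 / 20) ^ 2 * J74) * zB
      ≤ (Z ^ 2 - 16 * zB ^ 2) * (zB - ((1 - κ ^ 2 / 20) ^ 2 * zB + 2 * (1 - κ ^ 2 / 20) * (κ ^ 2 / 20) * J52
          - 2 * (1 - κ ^ 2 / 20) * (Zp / Z) * J41 + (κ ^ 2 / 20) ^ 2 * J72 - 2 * (κ ^ 2 / 20) * (Zp / Z) * J61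
          + (Zp / Z) ^ 2 * m2)) := by
  have hκ : 0 ≤ κ := hκ0.le
  obtain ⟨hZl, hZu⟩ := Z_bracket hκ hκ1
  obtain ⟨hZpl, hZpu⟩ := Zp_bracket hκ hκ1
  obtain ⟨hBl, hBu⟩ := zB_bracket hκ hκ1
  have hm2l : 0 ≤ ∫ r in (0:ℝ)..1, r ^ 5 * ∫ g : Matrix.specialUnitaryGroup (Fin 2) ℂ,
        Real.exp (κ * r * (su2Quat g).re) ∂haarProbability (Matrix.specialUnitaryGroup (Fin 2) ℂ) := by
    simpa using ball_nonneg 0 5 hκ hκ1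
  have hJ61l : 0 ≤ ∫ r in (0:ℝ)..1, r ^ 6 * ∫ g : Matrix.specialUnitaryGroup (Fin 2) ℂ,
        (su2Quat g).re * Real.exp (κ * r * (su2Quat g).re) ∂haarProbability (Matrix.specialUnitaryGroup (Fin 2) ℂ) := by
    simpa using ball_nonneg 1 6 hκ hκ1
  subst hZ hZp hzB hm2 hJ41 hJ52 hJ61 hJ72 hJ63 hJ74
  obtain ⟨b1, b2, b3, b4, b5, b6, b7, b8, b9, b10, b11⟩ := rational_brackets hκ hκ1 hZl hZu hZpl hZpu hBl hBu
  exact cert_arith hκ0 hκ1 b1 b2 b3 b4 b5 b6 hm2l (m2_le hκ hκ1) (J41_lower hκ hκ1) (ball_nonneg 2 5 hκ hκ1)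
    (J52_le hκ hκ1) hJ61l (ball_nonneg 2 7 hκ hκ1) (J72_le hκ hκ1) (ball_nonneg 3 6 hκ hκ1) (J63_le hκ hκ1)
    (ball_nonneg 4 7 hκ hκ1) (J74_le hκ hκ1) b7 b8 b9 b10 b11

end Summit.QuantumFields.BalabanUV.InfraRed.StrongCouplingBallCertificate

end
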